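/-
Copyright (c) 2026 the pub-hodgecm-mathlib formalisation cell (harness21).  Prover seat hodgecm-mathlib-K2E3-p31 (g0), HCML Track B «K2-LIT»,
h413 = `stmt-HodgeConjecture-24833`, line `K2_E3_EllipticInputs`, unit U12 «Characters», PART «SC» (ED. 2) leaf (SC-an)₂
`sig_K2E3SupercuspidalTruncatedCharAnalyticTwo`, road «FC₂» ∕ (M5h₂) chain (LINE-LEAD K2E3-plan (g4) deal D153 BY NAME 2026-09-04T15:11:03Z, split of K2E3-p32 (g0)'s D137):
brick [M4]₂ — Harish-Chandra's Theorem 20 PAYS the truncated character integral of a supercuspidal coefficient at a split-regular element of the field model `U(σ, Φ₂)(K)`,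
the `Fin 2` twin of ★ [M4] `K2E3SupercuspidalTruncatedCharThm20` (K2E3-p20 (g3)), HYPOTHESIS-FIRST over Theorem 20 on the full level for `U(σ, Φ₂)(K)` (K2E3-p32 (g0)'s
`K2E3CuspFormCancellationU2LevelOne`, in flight).  2026-09-04.
-/
import Summits.HodgeConjecture.HodgeConjecture.Theorems.K2E3SupercuspidalTruncatedCharThm20RadiusTwo   -- ★ p861231 (M5d)₂ ANY-RANK (K2E3-p14 g8): `setIntegral_sdiff_heightBall_conj_eq_zero_of_levelOne`,
                                                                                                   --   `truncated_conj_eq_inter_and_tendsto_of_levelOne` (Theorem 20 on `K₁` ⟹ shell vanishing ⟹ the two shapes)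
import Summits.HodgeConjecture.HodgeConjecture.Theorems.K2E3SupercuspOrbitalSliceCuspidalModelTwo  -- ★ p861233 [M1]₂ (K2E3-p37 g0): the supercuspidal slice on `U(σ, Φ₂)(K)` is a cusp form (`…_eq_zero_of_isSupercuspidal` along `N₂`,
                                                                                                   --   `…_map_conj_weylLongU_…` along `N̄₂`, `continuous_coeff_conj`)
import Literature.NumberTheory.Automorphic.UnitaryGroupBorelInduction                              -- ★ `borelTriple` (`.N = unipotentU`, `.M = torusU`, `rfl`), the Borel pair of `U(σ, Φ_N)(K)`
import HarnessLib

/-!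
# K2_E3 road (h413), socket (SC-an)₂, [M4]₂: THEOREM 20 PAYS THE TRUNCATED SUPERCUSPIDAL CHARACTER AT SPLIT-REGULAR ELEMENTS OF `U(σ, Φ₂)(K)` —
# `∫_{Ω n ∖ Ω R(g)} θ(x g x⁻¹) dx = 0`, `Θₙ(g) = ∫_{Ω n ∩ Ω R(g)}`, `Θₙ(g) → Θ_{R(g)}(g)` — HYPOTHESIS-FIRST over Theorem 20 on `K₁ = U ∩ GL₂(𝒪)`

Cell `pub/hodgecm-mathlib`, Track B «K2-LIT», crux H413 = `stmt-HodgeConjecture-24833` (`--supports … --as helper`, count-neutral); L4 LINE-LEAD K2E3-plan (g4) D153;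
chain desk K2E3-p27 (g0); consumers: K2E1-p10 (g3) D144 `K2E3SupercuspidalTruncatedCharLimCancTwo` (slot (1): ★ [M6] :115–:122's calls with `3 ↦ 2`).  THEOREMS ONLY (no `def`,
no `instance`, no `notation`, no named-fact hypothesis, no `sorry`); ★-only imports.  The `Fin 2` TWIN of ★ [M4] `Theorems/K2E3SupercuspidalTruncatedCharThm20.lean` (K2E3-p20 (g3)),
same two head names in the namespace `…Cruxes.H413.K2E3SupercuspidalTruncatedCharThm20Two`.

[HarishChandra1970, VII §3 p. 71 eq. (1)] read WITHOUT Theorem 18: for `g = y t y⁻¹` (`t ∈ T` regular) and `θ = B u' (ρ(·) u)` a coefficient of a smooth SUPERCUSPIDAL `ρ` of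
`U = U(σ, Φ₂)(K)`, `θ(x g x⁻¹) = f_t(x y)` with `f_t ∈ Φ_C` — ★ [M1]₂ `K2E3SupercuspOrbitalSliceCuspidalModelTwo` (K2E3-p37 (g0)): continuous, cuspidal along `N₂` and
`N̄₂ = w₀ N₂ w₀⁻¹` for every Haar measure (NO `σ² = 1` ∕ `2 ≠ 0` hypotheses at `N = 2`: the rank-one line twist); support `⊆ C·T` — the hypothesis `hsupp`, Harish-Chandra's
Lemma 14, discharged at `K = L_w` by ★ [M2a]₂ FILE B `K2E3SupercuspModelFrameAtPlaceCartanTwo.exists_isCompact_support_coeff_conj_subset_mul_torusU`.  THEOREM 20 on the full level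
`K₁` for `U(σ, Φ₂)(K)` is K2E3-p32 (g0)'s `K2E3CuspFormCancellationU2LevelOne.cuspForm_cancellation_levelOne_U2` (D137 FILE 3, the `Fin 2` twin of ★ [M3] `…_levelOne_U3`, in flight):
it is taken here as ONE HYPOTHESIS **`hT20`** — its literal conclusion `∫_{K₁} f(x k y) dμ(k) = 0` (`y ∈ Ω_s`, `x ∉ Ω_{m_C + (1 + 2s + 4m_C) + s}`) ∀-closed over the Haar data
`ν`, `ν̄` on `↥N₂`, `↥N̄₂` (the ★ [M3] instance set), the conjugator `y`, the cusp form `f : U → ℂ` with its support datum `(C, m_C)` and its two cuspidality clauses, at THIS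
file's fixed frame `(σ, J = Φ₂, μ, Ω)` — so that the DOCK is positional: `hT20 := fun ν _ _ _ _ ν̄ _ _ _ _ s y hy f hf C mC hC hsupp hcusp hcuspbar x hx =>
K2E3CuspFormCancellationU2LevelOne.cuspForm_cancellation_levelOne_U2 σ hσc hσv hJ μ ν ν̄ hϖ Ω hmem hinv hmul hy f hf C hC hsupp hcusp hcuspbar hx`.  Given `hT20`, the compact `C` of
`hsupp` is swallowed by some `Ω_{m_C}` (`CompactExhaustion.exists_superset_of_isCompact`), `y ∈ Ω_s` for some `s` (`CompactExhaustion.exists_mem`), and ★ p861231's ANY-RANK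
packaging (K2E3-p14 (g8): the shell `Ω n ∖ Ω R` is right-`K₁`-invariant, `K₁ ⊆ Ω 0` compact open, ★ (f1)) yields at `R = m_C + (1 + 2s + 4m_C) + s`:
* **`setIntegral_sdiff_heightBall_coeff_conj_eq_zero`** — the shell vanishing, `∃ R, ∀ n, ∫ x in Ω n ∖ Ω R, θ(x (y t y⁻¹) x⁻¹) dμ = 0`;
* **`exists_heightBall_truncatedCoeff_eq_inter_and_tendsto`** — `∃ R, (∀ n, Θₙ = ∫_{Ω n ∩ Ω R}) ∧ Θₙ → Θ_R` (the `hcanc`∕`hlim` shapes of ★ [M6]₂ LimCanc₂ at a split-regular `g`).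
BINDERS = ★ [M4]'s with `3 ↦ 2`, EXCEPT: `hσ` (`σ² = 1`), `hσv`, `h2`, `hϖ` DROPPED (idle at `N = 2`: ★ [M1]₂ needs neither `hσ` nor `h2`; ★ p861231 needs only `(ϖ : K)` through
`hmem`; `hσv`, `hϖ` live inside `hT20`'s discharge) and `(hT20)` ADDED right after `hmul`.  The explicit-radius (M5d)₂ coefficient heads (★ (M5d) :61 ∕ :162 with `3 ↦ 2`,
K2E3-p36 (g0)'s letter `hM5d`) are NOT here: they are K2E3-p14 (g8)'s dock `…Thm20RadiusTwoCoeff` (bus 15:13:34Z).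

HONEST LABEL: HC_CM is proved only modulo the 7 printed citations (2 remaining named inputs: hLiu418 = stmt-HodgeConjecture-24832, h413 =
stmt-HodgeConjecture-24833) until rung 0 closes; this file is a count-neutral helper; [M4]₂ is REL over EXACTLY {Theorem 20 on `K₁` for `U(σ, Φ₂)(K)`} (binder `hT20`);
(SC-an)₂ stays OPEN until COLL₂ + NC₂ + the whole (M5h₂) chain are ★.

## References
* [HarishChandra1970] Harish-Chandra (notes by G. van Dijk), *Harmonic Analysis on Reductive p-adic Groups*, LNM 162 (1970), Part VII §2 Theorem 20 p. 70;
  §3 p. 71 eq. (1), p. 72.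
* [Rogawski1990] J. D. Rogawski, *Automorphic Representations of Unitary Groups in Three Variables*, Ann. of Math. Stud. 123 (1990), §1.10 p. 9, §4.9 p. 54.
* [Casselman1995] W. Casselman, *Introduction to the theory of admissible representations of p-adic reductive groups* (1995), Prop. 1.4.4.
* [Folland1995] G. B. Folland, *A Course in Abstract Harmonic Analysis* (1995), §2.4, §2.6.
-/

set_option autoImplicit false
-- the mandated namespace repeats the single-problem summit's segment (`HodgeConjecture.HodgeConjecture`)
set_option linter.dupNamespace false

noncomputable section

open MeasureTheory Measure Set Filter Topology
open scoped NNReal ENNReal Pointwise Matrix MatrixGroups WithZero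
open ValuativeRel
open Literature.NumberTheory.Automorphic Literature.NumberTheory.Automorphic.UnitaryGroup Literature.NumberTheory.Rogawski1990

namespace Summit.HodgeConjecture.HodgeConjecture.Cruxes.H413.K2E3SupercuspidalTruncatedCharThm20Two

variable {K : Type*} [Field K] [Valued K ℤᵐ⁰] [ValuativeRel K] [(Valued.v : Valuation K ℤᵐ⁰).Compatible] [IsNonarchimedeanLocalField K]

set_option synthInstance.maxHeartbeats 400000 in
set_option maxHeartbeats 1600000 in
-- instance-term unification on the model carriers (same class and value as the ★ `Fin 3` template)
/-- **THE SHELL VANISHING `∫_{Ω n ∖ Ω R} θ(x g x⁻¹) dx = 0` FOR `g = y t y⁻¹` SPLIT-REGULAR** (`t = diag d` regular, any `y`), `θ = B u' (ρ(·) u)` a coefficient of a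
smooth supercuspidal `ρ` of `U(σ, Φ₂)(K)`, `μ` a left- and right-invariant Haar measure, `Ω` the height-ball exhaustion: ONE radius `R` serves every `n`.
HYPOTHESIS-FIRST over `hT20` = Theorem 20 on `K₁ = U ∩ GL₂(𝒪)` for `U(σ, Φ₂)(K)` (K2E3-p32 (g0)'s `cuspForm_cancellation_levelOne_U2`, ∀-closed over its Haar data, conjugator and
cusp form), fed with ★ [M1]₂ (`hcusp`, `hcuspbar` for the Haar measures of `N₂`, `N̄₂`, continuity) and `hsupp`, then ★ p861231's any-rank packaging at
`R = m_C + (1 + 2s + 4m_C) + s`.  The `Fin 2` twin of ★ [M4] `setIntegral_sdiff_heightBall_coeff_conj_eq_zero`.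
[cite: HarishChandra1970, Part VII §2 Theorem 20 p. 70; §3 p. 71 eq. (1)] [cite: Rogawski1990, §4.9 p. 54] -/
theorem setIntegral_sdiff_heightBall_coeff_conj_eq_zero [SecondCountableTopology K] [SecondCountableTopology (GL (Fin 2) K)]
    [MeasurableSpace K] [BorelSpace K]
    (σ : K →+* K) (hσc : Continuous σ)
    {J : Matrix (Fin 2) (Fin 2) K} (hJ : J = (StdForm.antidiagonal 2).over K)
    [MeasurableSpace ↥(unitaryGroupOfForm σ J)] [BorelSpace ↥(unitaryGroupOfForm σ J)]
    [SecondCountableTopology ↥(unitaryGroupOfForm σ J)] [LocallyCompactSpace ↥(unitaryGroupOfForm σ J)]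
    (μ : Measure ↥(unitaryGroupOfForm σ J)) [μ.IsHaarMeasure] [μ.IsMulRightInvariant]
    {ϖ : K} {ϖ' : K} (hϖ'0 : ϖ' ≠ 0) (hϖ'1 : valuation K ϖ' < 1) (hσϖ' : σ ϖ' = ϖ')
    (hZs : ∀ z ∈ Subgroup.center ↥(unitaryGroupOfForm σ J), ∃ c : Kˣ,
      ((z : ↥(unitaryGroupOfForm σ J)) : GL (Fin 2) K) = Matrix.GeneralLinearGroup.scalar (Fin 2) c)
    (hZc : IsCompact ((Subgroup.center ↥(unitaryGroupOfForm σ J) : Subgroup ↥(unitaryGroupOfForm σ J)) : Set ↥(unitaryGroupOfForm σ J)))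
    (Ω : CompactExhaustion ↥(unitaryGroupOfForm σ J))
    (hmem : ∀ (m : ℕ) (g : ↥(unitaryGroupOfForm σ J)), g ∈ Ω m ↔
      (∀ i j, Valued.v (ϖ ^ m * ((g : GL (Fin 2) K) : Matrix (Fin 2) (Fin 2) K) i j) ≤ 1) ∧
        ∀ i j, Valued.v (ϖ ^ m * (((g : GL (Fin 2) K)⁻¹ : GL (Fin 2) K) : Matrix (Fin 2) (Fin 2) K) i j) ≤ 1)
    (hinv : ∀ (m : ℕ) (g : ↥(unitaryGroupOfForm σ J)), g ∈ Ω m → g⁻¹ ∈ Ω m)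
    (hmul : ∀ (a b : ℕ) (g h : ↥(unitaryGroupOfForm σ J)), g ∈ Ω a → h ∈ Ω b → g * h ∈ Ω (a + b))
    (hT20 : ∀ (ν : Measure ↥((borelTriple σ J hJ).N)) [SFinite ν] [ν.IsOpenPosMeasure] [IsFiniteMeasureOnCompacts ν] [ν.IsMulLeftInvariant]
      (νbar : Measure ↥(((borelTriple σ J hJ).N).map (MulAut.conj (weylLongU σ hJ)).toMonoidHom))
      [SFinite νbar] [νbar.IsOpenPosMeasure] [IsFiniteMeasureOnCompacts νbar] [νbar.IsMulLeftInvariant]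
      {s : ℕ} {y : ↥(unitaryGroupOfForm σ J)}, y ∈ Ω s →
      ∀ (f : ↥(unitaryGroupOfForm σ J) → ℂ), Continuous f → ∀ (C : Set ↥(unitaryGroupOfForm σ J)) {mC : ℕ}, C ⊆ Ω mC →
      (∀ g, f g ≠ 0 → g ∈ C * (((borelTriple σ J hJ).M : Subgroup ↥(unitaryGroupOfForm σ J)) : Set ↥(unitaryGroupOfForm σ J))) →
      (∀ x : ↥(unitaryGroupOfForm σ J), ∫ n : ↥((borelTriple σ J hJ).N), f (x * ↑n) ∂ν = 0) →
      (∀ x : ↥(unitaryGroupOfForm σ J), ∫ v : ↥(((borelTriple σ J hJ).N).map (MulAut.conj (weylLongU σ hJ)).toMonoidHom), f (x * ↑v) ∂νbar = 0) →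
      ∀ {x : ↥(unitaryGroupOfForm σ J)}, x ∉ Ω (mC + (1 + 2 * s + 4 * mC) + s) →
      ∫ k in (((congruenceGL 2 (1 : ValueGroupWithZero K)).comap (unitaryGroupOfForm σ J).subtype : Subgroup ↥(unitaryGroupOfForm σ J)) :
        Set ↥(unitaryGroupOfForm σ J)), f (x * k * y) ∂μ = 0)
    {V : Type*} [AddCommGroup V] [Module ℂ V] (ρ : Representation ℂ ↥(unitaryGroupOfForm σ J) V) (hsm : ρ.IsSmooth) (hsc : ρ.IsSupercuspidal)
    (B : V →ₗ⋆[ℂ] V →ₗ[ℂ] ℂ) (hBinv : ∀ (g : ↥(unitaryGroupOfForm σ J)) (x y : V), B (ρ g x) (ρ g y) = B x y) (u u' : V)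
    (t : ↥(unitaryGroupOfForm σ J)) {d : Fin 2 → Kˣ} (hd : glDiagonal 2 K d = (t : GL (Fin 2) K)) (hreg : IsRegularElt (t : GL (Fin 2) K))
    (hsupp : ∃ C : Set ↥(unitaryGroupOfForm σ J), IsCompact C ∧ ∀ x : ↥(unitaryGroupOfForm σ J), B u' (ρ (x * t * x⁻¹) u) ≠ 0 →
      x ∈ C * ((torusU σ J : Subgroup ↥(unitaryGroupOfForm σ J)) : Set ↥(unitaryGroupOfForm σ J)))
    (y : ↥(unitaryGroupOfForm σ J)) :
    ∃ R : ℕ, ∀ n : ℕ, ∫ x in Ω n \ Ω R, B u' (ρ (x * (y * t * y⁻¹) * x⁻¹) u) ∂μ = 0 := by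
  haveI : T2Space K := (Literature.NumberTheory.GaloisRepresentations.IsNonarchimedeanLocalField.isLocalField K).toT2Space
  -- `N₂` and `N̄₂` are closed subgroups of the locally compact `U`: Haar measures on both
  have hN : IsClosed (((borelTriple σ J hJ).N : Subgroup ↥(unitaryGroupOfForm σ J)) : Set ↥(unitaryGroupOfForm σ J)) :=
    (isClosed_upperUnitriangular (n := 2) (R := K)).preimage continuous_subtype_val
  have hNbar : IsClosed ((((borelTriple σ J hJ).N).map (MulAut.conj (weylLongU σ hJ)).toMonoidHom : Subgroup ↥(unitaryGroupOfForm σ J)) :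
      Set ↥(unitaryGroupOfForm σ J)) := by
    have himg : ((((borelTriple σ J hJ).N).map (MulAut.conj (weylLongU σ hJ)).toMonoidHom : Subgroup ↥(unitaryGroupOfForm σ J)) :
        Set ↥(unitaryGroupOfForm σ J)) =
        ((Homeomorph.mulLeft (weylLongU σ hJ)).trans (Homeomorph.mulRight (weylLongU σ hJ)⁻¹)) ''
          (((borelTriple σ J hJ).N : Subgroup ↥(unitaryGroupOfForm σ J)) : Set ↥(unitaryGroupOfForm σ J)) := by
      rw [Subgroup.coe_map]
      rfl
    rw [himg]
    exact (Homeomorph.isClosed_image _).2 hN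
  -- (the subtype measurable structures on `↥N₂`, `↥N̄₂` are Borel: Mathlib `Subtype.borelSpace`)
  haveI : LocallyCompactSpace ↥((borelTriple σ J hJ).N) := hN.isClosedEmbedding_subtypeVal.locallyCompactSpace
  haveI : LocallyCompactSpace ↥(((borelTriple σ J hJ).N).map (MulAut.conj (weylLongU σ hJ)).toMonoidHom) :=
    hNbar.isClosedEmbedding_subtypeVal.locallyCompactSpace
  haveI : SecondCountableTopology ↥((borelTriple σ J hJ).N) := TopologicalSpace.Subtype.secondCountableTopology _
  haveI : SecondCountableTopology ↥(((borelTriple σ J hJ).N).map (MulAut.conj (weylLongU σ hJ)).toMonoidHom) :=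
    TopologicalSpace.Subtype.secondCountableTopology _
  set ν : Measure ↥((borelTriple σ J hJ).N) := Measure.haar with hν
  set νbar : Measure ↥(((borelTriple σ J hJ).N).map (MulAut.conj (weylLongU σ hJ)).toMonoidHom) := Measure.haar with hνbar
  -- the slice `f_t` is a cusp form (★ [M1]₂)
  have hf : Continuous fun x : ↥(unitaryGroupOfForm σ J) => B u' (ρ (x * t * x⁻¹) u) :=
    K2E3SupercuspOrbitalSliceCuspidalModelTwo.continuous_coeff_conj σ ρ hsm B t u u'
  have hcusp : ∀ x : ↥(unitaryGroupOfForm σ J), ∫ n : ↥((borelTriple σ J hJ).N),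
      (fun x : ↥(unitaryGroupOfForm σ J) => B u' (ρ (x * t * x⁻¹) u)) (x * ↑n) ∂ν = 0 := fun x =>
    K2E3SupercuspOrbitalSliceCuspidalModelTwo.integral_coeff_slice_unipotentU_eq_zero_of_isSupercuspidal σ hσc hJ hZs hZc hϖ'0 hϖ'1 hσϖ'
      ρ hsm hsc B hBinv ν t hd hreg u u' x
  have hcuspbar : ∀ x : ↥(unitaryGroupOfForm σ J), ∫ v : ↥(((borelTriple σ J hJ).N).map (MulAut.conj (weylLongU σ hJ)).toMonoidHom),
      (fun x : ↥(unitaryGroupOfForm σ J) => B u' (ρ (x * t * x⁻¹) u)) (x * ↑v) ∂νbar = 0 := fun x =>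
    K2E3SupercuspOrbitalSliceCuspidalModelTwo.integral_coeff_slice_unipotentU_map_conj_weylLongU_eq_zero_of_isSupercuspidal σ hσc hJ hZs hZc
      hϖ'0 hϖ'1 hσϖ' ρ hsm hsc B hBinv νbar t hd hreg u u' x
  -- the support datum `(C, m_C)` and the height `s` of `y`
  obtain ⟨C, hCc, hC⟩ := hsupp
  obtain ⟨mC, hmC⟩ := Ω.exists_superset_of_isCompact hCc
  obtain ⟨s, hy⟩ := Ω.exists_mem y
  refine ⟨mC + (1 + 2 * s + 4 * mC) + s, fun n => ?_⟩
  -- THEOREM 20 on the full level `K₁` (the letter), read for the slice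
  have h20 : ∀ x : ↥(unitaryGroupOfForm σ J), x ∉ Ω (mC + (1 + 2 * s + 4 * mC) + s) →
      ∫ k in (((congruenceGL 2 (1 : ValueGroupWithZero K)).comap (unitaryGroupOfForm σ J).subtype : Subgroup ↥(unitaryGroupOfForm σ J)) :
        Set ↥(unitaryGroupOfForm σ J)), (fun g : ↥(unitaryGroupOfForm σ J) => B u' (ρ g u)) (x * k * y * t * (x * k * y)⁻¹) ∂μ = 0 :=
    fun x hx => hT20 ν νbar hy (fun x : ↥(unitaryGroupOfForm σ J) => B u' (ρ (x * t * x⁻¹) u)) hf C hmC hC hcusp hcuspbar hx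
  -- ★ p861231's any-rank packaging
  exact K2E3SupercuspidalTruncatedCharThm20RadiusTwo.setIntegral_sdiff_heightBall_conj_eq_zero_of_levelOne σ hσc μ ϖ Ω hmem hinv hmul
    (fun g : ↥(unitaryGroupOfForm σ J) => B u' (ρ g u)) t y hf n h20

set_option synthInstance.maxHeartbeats 400000 in
set_option maxHeartbeats 1600000 in
-- instance-term unification on the model carriers (same class and value as the ★ `Fin 3` template)
/-- **THE TWO CONSUMER SHAPES AT A SPLIT-REGULAR `g = y t y⁻¹`** (model side): with `Θₙ(g) := ∫_{Ω n} B u' (ρ(x g x⁻¹) u) dμ(x)`, ONE radius `R = R(g)` gives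
`Θₙ(g) = ∫_{Ω n ∩ Ω R} B u' (ρ(x g x⁻¹) u) dμ` for every `n` (the `hcanc` shape, compact ball `Ω R`) AND `Θₙ(g) → Θ_R(g)` (the `hlim` shape, `F g := Θ_R(g)`) — HYPOTHESIS-FIRST over
the same letter `hT20`; ★ [M1]₂, then ★ p861231 `truncated_conj_eq_inter_and_tendsto_of_levelOne`.  The `Fin 2` twin of ★ [M4] `exists_heightBall_truncatedCoeff_eq_inter_and_tendsto`.
[cite: HarishChandra1970, Part VII §3 p. 71 eq. (1), p. 72] -/
theorem exists_heightBall_truncatedCoeff_eq_inter_and_tendsto [SecondCountableTopology K] [SecondCountableTopology (GL (Fin 2) K)]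
    [MeasurableSpace K] [BorelSpace K]
    (σ : K →+* K) (hσc : Continuous σ)
    {J : Matrix (Fin 2) (Fin 2) K} (hJ : J = (StdForm.antidiagonal 2).over K)
    [MeasurableSpace ↥(unitaryGroupOfForm σ J)] [BorelSpace ↥(unitaryGroupOfForm σ J)]
    [SecondCountableTopology ↥(unitaryGroupOfForm σ J)] [LocallyCompactSpace ↥(unitaryGroupOfForm σ J)]
    (μ : Measure ↥(unitaryGroupOfForm σ J)) [μ.IsHaarMeasure] [μ.IsMulRightInvariant]
    {ϖ : K} {ϖ' : K} (hϖ'0 : ϖ' ≠ 0) (hϖ'1 : valuation K ϖ' < 1) (hσϖ' : σ ϖ' = ϖ')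
    (hZs : ∀ z ∈ Subgroup.center ↥(unitaryGroupOfForm σ J), ∃ c : Kˣ,
      ((z : ↥(unitaryGroupOfForm σ J)) : GL (Fin 2) K) = Matrix.GeneralLinearGroup.scalar (Fin 2) c)
    (hZc : IsCompact ((Subgroup.center ↥(unitaryGroupOfForm σ J) : Subgroup ↥(unitaryGroupOfForm σ J)) : Set ↥(unitaryGroupOfForm σ J)))
    (Ω : CompactExhaustion ↥(unitaryGroupOfForm σ J))
    (hmem : ∀ (m : ℕ) (g : ↥(unitaryGroupOfForm σ J)), g ∈ Ω m ↔
      (∀ i j, Valued.v (ϖ ^ m * ((g : GL (Fin 2) K) : Matrix (Fin 2) (Fin 2) K) i j) ≤ 1) ∧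
        ∀ i j, Valued.v (ϖ ^ m * (((g : GL (Fin 2) K)⁻¹ : GL (Fin 2) K) : Matrix (Fin 2) (Fin 2) K) i j) ≤ 1)
    (hinv : ∀ (m : ℕ) (g : ↥(unitaryGroupOfForm σ J)), g ∈ Ω m → g⁻¹ ∈ Ω m)
    (hmul : ∀ (a b : ℕ) (g h : ↥(unitaryGroupOfForm σ J)), g ∈ Ω a → h ∈ Ω b → g * h ∈ Ω (a + b))
    (hT20 : ∀ (ν : Measure ↥((borelTriple σ J hJ).N)) [SFinite ν] [ν.IsOpenPosMeasure] [IsFiniteMeasureOnCompacts ν] [ν.IsMulLeftInvariant]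
      (νbar : Measure ↥(((borelTriple σ J hJ).N).map (MulAut.conj (weylLongU σ hJ)).toMonoidHom))
      [SFinite νbar] [νbar.IsOpenPosMeasure] [IsFiniteMeasureOnCompacts νbar] [νbar.IsMulLeftInvariant]
      {s : ℕ} {y : ↥(unitaryGroupOfForm σ J)}, y ∈ Ω s →
      ∀ (f : ↥(unitaryGroupOfForm σ J) → ℂ), Continuous f → ∀ (C : Set ↥(unitaryGroupOfForm σ J)) {mC : ℕ}, C ⊆ Ω mC →
      (∀ g, f g ≠ 0 → g ∈ C * (((borelTriple σ J hJ).M : Subgroup ↥(unitaryGroupOfForm σ J)) : Set ↥(unitaryGroupOfForm σ J))) →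
      (∀ x : ↥(unitaryGroupOfForm σ J), ∫ n : ↥((borelTriple σ J hJ).N), f (x * ↑n) ∂ν = 0) →
      (∀ x : ↥(unitaryGroupOfForm σ J), ∫ v : ↥(((borelTriple σ J hJ).N).map (MulAut.conj (weylLongU σ hJ)).toMonoidHom), f (x * ↑v) ∂νbar = 0) →
      ∀ {x : ↥(unitaryGroupOfForm σ J)}, x ∉ Ω (mC + (1 + 2 * s + 4 * mC) + s) →
      ∫ k in (((congruenceGL 2 (1 : ValueGroupWithZero K)).comap (unitaryGroupOfForm σ J).subtype : Subgroup ↥(unitaryGroupOfForm σ J)) :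
        Set ↥(unitaryGroupOfForm σ J)), f (x * k * y) ∂μ = 0)
    {V : Type*} [AddCommGroup V] [Module ℂ V] (ρ : Representation ℂ ↥(unitaryGroupOfForm σ J) V) (hsm : ρ.IsSmooth) (hsc : ρ.IsSupercuspidal)
    (B : V →ₗ⋆[ℂ] V →ₗ[ℂ] ℂ) (hBinv : ∀ (g : ↥(unitaryGroupOfForm σ J)) (x y : V), B (ρ g x) (ρ g y) = B x y) (u u' : V)
    (t : ↥(unitaryGroupOfForm σ J)) {d : Fin 2 → Kˣ} (hd : glDiagonal 2 K d = (t : GL (Fin 2) K)) (hreg : IsRegularElt (t : GL (Fin 2) K))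
    (hsupp : ∃ C : Set ↥(unitaryGroupOfForm σ J), IsCompact C ∧ ∀ x : ↥(unitaryGroupOfForm σ J), B u' (ρ (x * t * x⁻¹) u) ≠ 0 →
      x ∈ C * ((torusU σ J : Subgroup ↥(unitaryGroupOfForm σ J)) : Set ↥(unitaryGroupOfForm σ J)))
    (y : ↥(unitaryGroupOfForm σ J)) :
    ∃ R : ℕ, (∀ n : ℕ, ∫ x in Ω n, B u' (ρ (x * (y * t * y⁻¹) * x⁻¹) u) ∂μ = ∫ x in Ω n ∩ Ω R, B u' (ρ (x * (y * t * y⁻¹) * x⁻¹) u) ∂μ) ∧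
      Tendsto (fun n : ℕ => ∫ x in Ω n, B u' (ρ (x * (y * t * y⁻¹) * x⁻¹) u) ∂μ) atTop
        (𝓝 (∫ x in Ω R, B u' (ρ (x * (y * t * y⁻¹) * x⁻¹) u) ∂μ)) := by
  obtain ⟨R, hR⟩ := setIntegral_sdiff_heightBall_coeff_conj_eq_zero σ hσc hJ μ hϖ'0 hϖ'1 hσϖ' hZs hZc Ω hmem hinv hmul hT20 ρ hsm hsc B hBinv
    u u' t hd hreg hsupp y
  have hφ : Continuous fun z : ↥(unitaryGroupOfForm σ J) => B u' (ρ (z * (y * t * y⁻¹) * z⁻¹) u) :=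
    K2E3SupercuspOrbitalSliceCuspidalModelTwo.continuous_coeff_conj σ ρ hsm B (y * t * y⁻¹) u u'
  have hmeas : ∀ n, MeasurableSet (Ω n) := fun n => (Ω.isCompact n).measurableSet
  have hint : ∀ n, IntegrableOn (fun z : ↥(unitaryGroupOfForm σ J) => B u' (ρ (z * (y * t * y⁻¹) * z⁻¹) u)) (Ω n) μ := fun n =>
    hφ.continuousOn.integrableOn_compact (Ω.isCompact n)
  exact ⟨R, K2E3RightInvariantSetIntegralVanishing.setIntegral_eq_setIntegral_inter_of_sdiff_eq_zero μ Ω hmeas R _ hint hR,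
    K2E3RightInvariantSetIntegralVanishing.tendsto_setIntegral_of_forall_sdiff_eq_zero μ Ω (fun _ _ h => Ω.subset h) hmeas R _ hint hR⟩

end Summit.HodgeConjecture.HodgeConjecture.Cruxes.H413.K2E3SupercuspidalTruncatedCharThm20Two

end
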